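import Summits.Ventures.GridStability.Lyapunov.CertificateSoundness
import Mathlib.Analysis.SpecialFunctions.ExpDeriv
import Mathlib.Analysis.SpecialFunctions.Sqrt
import HarnessLib

/-!
# Certified DECAY RATES from Lyapunov sublevel certificates, curve form: from the extra certified
# inequality `V̇ ≤ -μ V` on the certified piece to `V(x t) ≤ V(x 0)·e^{-μt}` and
# `‖x t − x₀‖ ≤ √(k₂/k₁)·‖x 0 − x₀‖·e^{−μt/2}` FOR THE MODEL (companion of `CertificateSoundness.lean`)

Venture GRIDFUSION, cell `gridfusion`, `plan/PARTITION.md` §0 row `Lyapunov/`; lead RULING 7d (2026-08-27T12:58Z)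
«SOS rows get [the certified decay rate] by adding `−V̇ − μV − σ(c − V) ∈ Σ²` to the program … the kernel side»;
seat gridfusion-lyap-2 (g3); namespace `Summit.Ventures.GridStability.Lyapunov`. Everything is PROVED (no definition,
no named fact, standard axioms).

WHAT THIS FILE IS. The RATE receptacle in the SAME vocabulary as `certificate_invariance_tendsto_univ`
(`CertificateSoundness.lean`, p460300), i.e. the CURVE FORM used by every `Bench/*Roa.lean` file of the cell
(SMIB/WSCC9/CHIANG3/K2A/DVOC/PLL/NE39Ks): a solution `x` of `x' = F x` on `[0, ∞)` in Mathlib's convention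
(`ContinuousOn x (Ici 0)`, right derivative `F (x t)`), the auxiliary function `V ∘ x` with right derivative
`LV (x t)` (`LV` = the emitted Lie-derivative polynomial, linked in the kernel by `PolyRecast.lieCheckK` /
`SOS.Poly`), a constraint set `M` (the recast manifold `{h = 0}`) and the certified piece `{y ∈ M | V y ≤ c}`.
The Literature companion `Literature/Analysis/ODE/LyapunovExponentialDecay.lean` (lit-6, Khalil Thm 4.10) is the
Fréchet-derivative / within-`Icc` form consumed by the Lur'e–Postnikov slab class
(`LuriePostnikovSlabDecayRate.lean`); the two differ only in packaging.

WHAT IS PROVED.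
* `le_mul_exp_neg_of_deriv_right_le` — the comparison step for RIGHT derivatives: `φ` continuous on `[a, b]`,
  right derivative `φ' t ≤ -μ φ t` on `[a, b)` ⇒ `φ t ≤ φ a · e^{-μ(t-a)}` (`t ↦ e^{μt}φ t` is non-increasing,
  `antitoneOn_of_deriv_right_nonpos`);
* `exp_decay_of_forall_mem` — along a solution that stays in a set `P` on which `LV ≤ -μ V`:
  `V (x t) ≤ V (x 0) · e^{-μt}` for all `t ≥ 0` (any topological phase space);
* `gauge_le_mul_exp_neg_of_forall_mem` / `…₂` — with `k₁ N ≤ V` (and `V ≤ k₂ N`) on `P`: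
  `N (x t) ≤ V(x 0)/k₁ · e^{-μt}` (`≤ (k₂/k₁) N(x 0) e^{-μt}`), `N` any gauge (`Σ zᵢ²`, `‖· − x₀‖²`, …);
* `norm_sub_le_sqrt_mul_exp_neg_of_forall_mem` / `…₂` — the Euclidean reading, `N y = ‖y − x₀‖²`:
  `‖x t − x₀‖ ≤ √(V(x 0)/k₁)·e^{−(μ/2)t}`, resp. `≤ √(k₂/k₁)·‖x 0 − x₀‖·e^{−(μ/2)t}` (Khalil's `(k₁, k₂, k₃, a)
  = (k₁, k₂, μk₂, 2)`);
* `certificate_exp_decay_univ` — THE RECEPTACLE: the hypotheses of `certificate_invariance_tendsto_univ` verbatim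
  plus ONE more certified inequality `LV ≤ -μ V` on `{y ∈ M | V y ≤ c}` ⇒ invariance ∧ `V (x t) ≤ V (x 0)e^{-μt}` ∧
  `x t → x₀`;
* `rate_certificate_univ` — a RATE certificate is by itself an ROA certificate: `LV ≤ -μ V` on the piece with
  `μ > 0`, `c > 0`, `V ≥ 0` on the piece vanishing only at `x₀` ⇒ the same three conclusions (take `W := μ V`).

THREE COLUMNS. CERTIFIED (elsewhere, per Bench file): the polynomial identity behind `LV ≤ -μ V` on the piece
(one more SOS multiplier, RULING 7d) and the gauge bounds `k₁ Σzᵢ² ≤ V ≤ k₂ Σzᵢ²` (the `Ball`-type PSD facts).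
MODELLED: every conclusion here is a statement about the ODE `x' = F x` (model `M′` of the Bench file) inside
the certified piece — a certified decay TIME CONSTANT `1/μ` for `V` (`2/μ` for the state deviation), sufficient
and not sharp; nothing here says a grid or a machine is well damped. VALIDATED: nothing (simulated decay and
small-signal damping ratios are printed BESIDE such a row, never as part of it). DATUM (this seat, 2026-08-27):
on the cell's objects of record the a-posteriori rate is vacuous (lossy slab certificates carry `η = 10⁻⁶`;
SOS certificates were optimised for region, not rate) — an informative RATE row needs a rate-optimised object.

Sources for the mathematics: H. K. Khalil, *Nonlinear Systems*, 3rd ed. (2002), Theorem 4.10 and its proof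
(`V̇ ≤ -(k₃/k₂)V` ⇒ `V(t) ≤ V(t₀)e^{-(k₃/k₂)(t-t₀)}` by the comparison lemma) [Khalil2002]; N. Rouche, P. Habets,
M. Laloy (1977) Ch. I §6 for the curve-form setting [RoucheHabetsLaloy1977]. Not here: non-autonomous `V`,
converse theorems, the slab class (Literature), any instance.
-/

noncomputable section

open Set Filter Metric Topology

namespace Summit.Ventures.GridStability.Lyapunov

/-! ### The comparison step for right derivatives -/

section Comparison

/-- **Exponential comparison, right-derivative form** (Khalil's step "`V̇ ≤ -(k₃/k₂)V` … by the
comparison lemma"): if `φ` is continuous on `[a, b]` and has a right derivative `φ' t ≤ -μ·φ t` at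
every `t ∈ [a, b)`, then `φ t ≤ φ a · e^{-μ (t - a)}` on `[a, b]` (for any real `μ`). Proof:
`t ↦ e^{μt} φ t` has right derivative `e^{μt}(μ φ t + φ' t) ≤ 0`, hence is non-increasing
(`antitoneOn_of_deriv_right_nonpos`). [cite: Khalil2002, Theorem 4.10 (proof) with Lemma 3.4] -/
theorem le_mul_exp_neg_of_deriv_right_le {φ φ' : ℝ → ℝ} {a b μ : ℝ}
    (hφ : ContinuousOn φ (Icc a b)) (hφ' : ∀ t ∈ Ico a b, HasDerivWithinAt φ (φ' t) (Ici t) t)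
    (hle : ∀ t ∈ Ico a b, φ' t ≤ -μ * φ t) :
    ∀ t ∈ Icc a b, φ t ≤ φ a * Real.exp (-μ * (t - a)) := by
  have hψc : ContinuousOn (fun t ↦ Real.exp (μ * t) * φ t) (Icc a b) :=
    (by fun_prop : Continuous fun t : ℝ ↦ Real.exp (μ * t)).continuousOn.mul hφ
  have hψ' : ∀ t ∈ Ico a b, HasDerivWithinAt (fun t ↦ Real.exp (μ * t) * φ t)
      (Real.exp (μ * t) * μ * φ t + Real.exp (μ * t) * φ' t) (Ici t) t := by
    intro t ht
    have he : HasDerivAt (fun s : ℝ ↦ Real.exp (μ * s)) (Real.exp (μ * t) * μ) t := by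
      have h := ((hasDerivAt_id t).const_mul μ).exp
      simpa using h
    exact he.hasDerivWithinAt.mul (hφ' t ht)
  have hanti := antitoneOn_of_deriv_right_nonpos hψc hψ' fun t ht ↦ by
    show Real.exp (μ * t) * μ * φ t + Real.exp (μ * t) * φ' t ≤ 0
    have hpos := Real.exp_pos (μ * t)
    have hs : μ * φ t + φ' t ≤ 0 := by linarith [hle t ht]
    nlinarith
  intro t ht
  have hab : a ≤ b := ht.1.trans ht.2
  have h := hanti (left_mem_Icc.2 hab) ht ht.1
  have hpos := Real.exp_pos (μ * t)
  have hea : Real.exp (-μ * (t - a)) * Real.exp (μ * t) = Real.exp (μ * a) := by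
    rw [← Real.exp_add]
    congr 1
    ring
  have heq : φ a * Real.exp (-μ * (t - a)) = Real.exp (μ * a) * φ a / Real.exp (μ * t) := by
    rw [eq_div_iff hpos.ne', mul_assoc, hea, mul_comm]
  rw [heq, le_div_iff₀ hpos]
  calc φ t * Real.exp (μ * t) = Real.exp (μ * t) * φ t := mul_comm _ _
    _ ≤ Real.exp (μ * a) * φ a := h

end Comparison

/-! ### Exponential decay of `V` and of a gauge along a solution that stays in the certified piece -/

section Decay

variable {E : Type*} [TopologicalSpace E]

/-- **Exponential decay of `V` along a solution, curve form.** Let `x : ℝ → E` be continuous on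
`[0, ∞)` with `x t ∈ P` for all `t ≥ 0` (e.g. `P` = the certified piece, by the invariance half of
`certificate_invariance_tendsto_univ`), `V` continuous on `P`, and let the auxiliary function `V ∘ x`
have right derivative `LV (x t)` at every `t ≥ 0`, where the CERTIFIED RATE INEQUALITY `LV ≤ -μ V`
holds on `P`. Then `V (x t) ≤ V (x 0) · e^{-μ t}` for all `t ≥ 0`. MODELLED: a statement about one
curve; nothing here mentions a grid. [cite: Khalil2002, Theorem 4.10 (proof)] -/
theorem exp_decay_of_forall_mem {V LV : E → ℝ} {P : Set E} {μ : ℝ} {x : ℝ → E}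
    (hVc : ContinuousOn V P) (hRate : ∀ y ∈ P, LV y ≤ -μ * V y)
    (hx : ContinuousOn x (Ici 0)) (hφ : ∀ t, 0 ≤ t → HasDerivWithinAt (V ∘ x) (LV (x t)) (Ici t) t)
    (hxP : ∀ t, 0 ≤ t → x t ∈ P) :
    ∀ t, 0 ≤ t → V (x t) ≤ V (x 0) * Real.exp (-μ * t) := by
  intro t ht
  have hcont : ContinuousOn (V ∘ x) (Icc 0 t) :=
    hVc.comp (hx.mono Icc_subset_Ici_self) fun s hs ↦ hxP s hs.1
  have h := le_mul_exp_neg_of_deriv_right_le (φ := V ∘ x) (φ' := fun s ↦ LV (x s)) (a := 0)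
    (b := t) (μ := μ) hcont (fun s hs ↦ hφ s hs.1) (fun s hs ↦ hRate (x s) (hxP s hs.1)) t
    ⟨ht, le_rfl⟩
  simpa using h

/-- **Exponential decay of a gauge dominated by `V`.** Under the hypotheses of
`exp_decay_of_forall_mem`, a lower bound `k₁ N ≤ V` on `P` (`k₁ > 0`; `N` = `Σ zᵢ²`, `‖· − x₀‖²`, …,
the certificate's positivity fact) gives `N (x t) ≤ V (x 0)/k₁ · e^{-μ t}` for all `t ≥ 0`.
[cite: Khalil2002, Theorem 4.10 (proof, last display)] -/
theorem gauge_le_mul_exp_neg_of_forall_mem {V LV N : E → ℝ} {P : Set E} {μ k₁ : ℝ} {x : ℝ → E}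
    (hVc : ContinuousOn V P) (hRate : ∀ y ∈ P, LV y ≤ -μ * V y) (hk₁ : 0 < k₁)
    (hN : ∀ y ∈ P, k₁ * N y ≤ V y)
    (hx : ContinuousOn x (Ici 0)) (hφ : ∀ t, 0 ≤ t → HasDerivWithinAt (V ∘ x) (LV (x t)) (Ici t) t)
    (hxP : ∀ t, 0 ≤ t → x t ∈ P) :
    ∀ t, 0 ≤ t → N (x t) ≤ V (x 0) / k₁ * Real.exp (-μ * t) := by
  intro t ht
  have h := exp_decay_of_forall_mem hVc hRate hx hφ hxP t ht
  have hN' := hN (x t) (hxP t ht)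
  rw [div_mul_eq_mul_div, le_div_iff₀ hk₁]
  calc N (x t) * k₁ = k₁ * N (x t) := mul_comm _ _
    _ ≤ V (x 0) * Real.exp (-μ * t) := hN'.trans h

/-- **Two-sided gauge form** (`k₁ N ≤ V ≤ k₂ N` on `P`): `N (x t) ≤ (k₂/k₁) · N (x 0) · e^{-μ t}` for
all `t ≥ 0` — Khalil's `(k₁, k₂, k₃) = (k₁, k₂, μ k₂)`. [cite: Khalil2002, Theorem 4.10] -/
theorem gauge_le_mul_exp_neg_of_forall_mem₂ {V LV N : E → ℝ} {P : Set E} {μ k₁ k₂ : ℝ}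
    {x : ℝ → E} (hVc : ContinuousOn V P) (hRate : ∀ y ∈ P, LV y ≤ -μ * V y) (hk₁ : 0 < k₁)
    (hN : ∀ y ∈ P, k₁ * N y ≤ V y) (hN₂ : ∀ y ∈ P, V y ≤ k₂ * N y)
    (hx : ContinuousOn x (Ici 0)) (hφ : ∀ t, 0 ≤ t → HasDerivWithinAt (V ∘ x) (LV (x t)) (Ici t) t)
    (hxP : ∀ t, 0 ≤ t → x t ∈ P) :
    ∀ t, 0 ≤ t → N (x t) ≤ k₂ / k₁ * N (x 0) * Real.exp (-μ * t) := by
  intro t ht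
  have h := gauge_le_mul_exp_neg_of_forall_mem hVc hRate hk₁ hN hx hφ hxP t ht
  have h2 : V (x 0) / k₁ * Real.exp (-μ * t) ≤ k₂ * N (x 0) / k₁ * Real.exp (-μ * t) :=
    mul_le_mul_of_nonneg_right (div_le_div_of_nonneg_right (hN₂ (x 0) (hxP 0 le_rfl)) hk₁.le)
      (Real.exp_pos _).le
  calc N (x t) ≤ k₂ * N (x 0) / k₁ * Real.exp (-μ * t) := h.trans h2
    _ = k₂ / k₁ * N (x 0) * Real.exp (-μ * t) := by ring

end Decay

/-! ### The Euclidean reading: decay of the state deviation -/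

section Normed

variable {E : Type*} [NormedAddCommGroup E]

/-- `e^{-μt} = (e^{-(μ/2)t})²` (plumbing). [folklore] -/
private theorem exp_neg_eq_sq (μ t : ℝ) :
    Real.exp (-μ * t) = Real.exp (-(μ / 2) * t) ^ 2 := by
  rw [sq, ← Real.exp_add]
  congr 1
  ring

/-- **Decay of the state deviation from the certified lower bound** `k₁‖y − x₀‖² ≤ V` on `P`:
`‖x t − x₀‖ ≤ √(V (x 0)/k₁) · e^{−(μ/2) t}` for all `t ≥ 0` (certified TIME CONSTANT `2/μ` for the
deviation inside the piece; sufficient, not sharp). [cite: Khalil2002, Theorem 4.10 and Definition 4.5] -/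
theorem norm_sub_le_sqrt_mul_exp_neg_of_forall_mem {V LV : E → ℝ} {P : Set E} {μ k₁ : ℝ}
    {x : ℝ → E} {x₀ : E} (hVc : ContinuousOn V P) (hRate : ∀ y ∈ P, LV y ≤ -μ * V y)
    (hk₁ : 0 < k₁) (hlow : ∀ y ∈ P, k₁ * ‖y - x₀‖ ^ 2 ≤ V y)
    (hx : ContinuousOn x (Ici 0)) (hφ : ∀ t, 0 ≤ t → HasDerivWithinAt (V ∘ x) (LV (x t)) (Ici t) t)
    (hxP : ∀ t, 0 ≤ t → x t ∈ P) :
    ∀ t, 0 ≤ t → ‖x t - x₀‖ ≤ Real.sqrt (V (x 0) / k₁) * Real.exp (-(μ / 2) * t) := by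
  intro t ht
  have h := gauge_le_mul_exp_neg_of_forall_mem (N := fun y ↦ ‖y - x₀‖ ^ 2) hVc hRate hk₁ hlow
    hx hφ hxP t ht
  calc ‖x t - x₀‖ = Real.sqrt (‖x t - x₀‖ ^ 2) := (Real.sqrt_sq (norm_nonneg _)).symm
    _ ≤ Real.sqrt (V (x 0) / k₁ * Real.exp (-μ * t)) := Real.sqrt_le_sqrt h
    _ = Real.sqrt (V (x 0) / k₁) * Real.exp (-(μ / 2) * t) := by
        rw [Real.sqrt_mul' _ (Real.exp_pos _).le, exp_neg_eq_sq μ t, Real.sqrt_sq (Real.exp_pos _).le]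

/-- **Two-sided Euclidean form** (`k₁‖y − x₀‖² ≤ V y ≤ k₂‖y − x₀‖²` on `P`):
`‖x t − x₀‖ ≤ √(k₂/k₁) · ‖x 0 − x₀‖ · e^{−(μ/2) t}` for all `t ≥ 0` — Khalil's
"`‖x(t)‖ ≤ (k₂/k₁)^{1/a}‖x(t₀)‖e^{-(k₃/(k₂ a))(t−t₀)}`" with `a = 2`, `k₃ = μ k₂`.
[cite: Khalil2002, Theorem 4.10 and Definition 4.5] -/
theorem norm_sub_le_sqrt_mul_exp_neg_of_forall_mem₂ {V LV : E → ℝ} {P : Set E} {μ k₁ k₂ : ℝ}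
    {x : ℝ → E} {x₀ : E} (hVc : ContinuousOn V P) (hRate : ∀ y ∈ P, LV y ≤ -μ * V y)
    (hk₁ : 0 < k₁) (hlow : ∀ y ∈ P, k₁ * ‖y - x₀‖ ^ 2 ≤ V y)
    (hup : ∀ y ∈ P, V y ≤ k₂ * ‖y - x₀‖ ^ 2)
    (hx : ContinuousOn x (Ici 0)) (hφ : ∀ t, 0 ≤ t → HasDerivWithinAt (V ∘ x) (LV (x t)) (Ici t) t)
    (hxP : ∀ t, 0 ≤ t → x t ∈ P) :
    ∀ t, 0 ≤ t →
      ‖x t - x₀‖ ≤ Real.sqrt (k₂ / k₁) * ‖x 0 - x₀‖ * Real.exp (-(μ / 2) * t) := by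
  intro t ht
  have h := gauge_le_mul_exp_neg_of_forall_mem₂ (N := fun y ↦ ‖y - x₀‖ ^ 2) hVc hRate hk₁ hlow
    hup hx hφ hxP t ht
  have h' : ‖x t - x₀‖ ^ 2 ≤ k₂ / k₁ * (‖x 0 - x₀‖ ^ 2 * Real.exp (-μ * t)) := by
    rw [← mul_assoc]; exact h
  calc ‖x t - x₀‖ = Real.sqrt (‖x t - x₀‖ ^ 2) := (Real.sqrt_sq (norm_nonneg _)).symm
    _ ≤ Real.sqrt (k₂ / k₁ * (‖x 0 - x₀‖ ^ 2 * Real.exp (-μ * t))) := Real.sqrt_le_sqrt h'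
    _ = Real.sqrt (k₂ / k₁) * ‖x 0 - x₀‖ * Real.exp (-(μ / 2) * t) := by
        rw [Real.sqrt_mul' _ (mul_nonneg (sq_nonneg _) (Real.exp_pos _).le),
          Real.sqrt_mul' _ (Real.exp_pos _).le, Real.sqrt_sq (norm_nonneg _), exp_neg_eq_sq μ t,
          Real.sqrt_sq (Real.exp_pos _).le, mul_assoc]

end Normed

/-! ### The receptacles: a certificate with a rate inequality -/

section Certificate

variable {E : Type*} [NormedAddCommGroup E] [NormedSpace ℝ E]

/-- **Soundness of a Lyapunov sublevel certificate WITH A CERTIFIED RATE (no-domain form).** The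
hypotheses of `certificate_invariance_tendsto_univ` verbatim (`S := {y ∈ M | V y ≤ c}` compact; `F`,
`V`, `W` continuous on `S`; `LV ≤ -W`, `W ≥ 0` on `S`, `W > 0` on `S ∩ {V = c}`, `x₀` the unique zero
of `W` on `S`; a solution `x` in `M` from `S` with `V ∘ x` right-differentiable with derivative
`LV (x t)`) plus ONE more certified inequality, `LV ≤ -μ·V` on `S` (the extra multiplier identity
«`−V̇ − μV − σ(c − V) ∈ Σ²`» decoded on `M`). Conclusion: for all `t ≥ 0`, `V (x t) ≤ c` AND
`V (x t) ≤ V (x 0) · e^{−μ t}`; and `x t → x₀`. MODELLED: a statement about the ODE `x' = F x`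
only; `1/μ` is a certified time constant for `V` inside the certified region, sufficient and not
sharp. [cite: Khalil2002, Theorem 4.10] -/
theorem certificate_exp_decay_univ {F : E → E} {V LV W : E → ℝ} {M : Set E} {c μ : ℝ}
    {x : ℝ → E} {x₀ : E} (hS : IsCompact {y ∈ M | V y ≤ c})
    (hF : ContinuousOn F {y ∈ M | V y ≤ c}) (hVc : ContinuousOn V {y ∈ M | V y ≤ c})
    (hW : ContinuousOn W {y ∈ M | V y ≤ c})
    (hLie : ∀ y ∈ M, V y ≤ c → LV y ≤ -W y) (hW0 : ∀ y ∈ M, V y ≤ c → 0 ≤ W y)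
    (hWc : ∀ y ∈ M, V y = c → 0 < W y)
    (hx₀ : x₀ ∈ M) (hx₀c : V x₀ ≤ c) (hWx₀ : W x₀ = 0)
    (hZ : ∀ y ∈ M, V y ≤ c → W y = 0 → y = x₀)
    (hRate : ∀ y ∈ M, V y ≤ c → LV y ≤ -μ * V y)
    (hx : ContinuousOn x (Ici 0)) (hxF : ∀ t, 0 ≤ t → HasDerivWithinAt x (F (x t)) (Ici t) t)
    (hφ : ∀ t, 0 ≤ t → HasDerivWithinAt (V ∘ x) (LV (x t)) (Ici t) t)
    (hxM : ∀ t, 0 ≤ t → x t ∈ M) (h0c : V (x 0) ≤ c) :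
    (∀ t, 0 ≤ t → V (x t) ≤ c ∧ V (x t) ≤ V (x 0) * Real.exp (-μ * t)) ∧
      Tendsto x atTop (𝓝 x₀) := by
  obtain ⟨hinv, htend⟩ := certificate_invariance_tendsto_univ hS hF hVc hW hLie hW0 hWc hx₀ hx₀c
    hWx₀ hZ hx hxF hφ hxM h0c
  have hdec := exp_decay_of_forall_mem (P := {y ∈ M | V y ≤ c}) hVc
    (fun y hy ↦ hRate y hy.1 hy.2) hx hφ fun t ht ↦ ⟨hxM t ht, hinv t ht⟩
  exact ⟨fun t ht ↦ ⟨hinv t ht, hdec t ht⟩, htend⟩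

/-- **A RATE certificate is an ROA certificate.** If on the piece `S := {y ∈ M | V y ≤ c}` (compact,
`F` and `V` continuous on it) the certified inequality `LV ≤ -μ·V` holds with `μ > 0` and `c > 0`, and
`V ≥ 0` on `S` with `V y = 0 → y = x₀` (`x₀ ∈ M`, `V x₀ = 0`: the certificate's positivity fact), then
along every solution `x` in `M` from `S` (curve-form hypotheses as above): `V (x t) ≤ c` and
`V (x t) ≤ V (x 0) · e^{−μ t}` for all `t ≥ 0`, and `x t → x₀` — `certificate_exp_decay_univ` with
the dissipation rate `W := μ·V`. MODELLED: a statement about the ODE `x' = F x` only.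
[cite: Khalil2002, Theorem 4.10] -/
theorem rate_certificate_univ {F : E → E} {V LV : E → ℝ} {M : Set E} {c μ : ℝ}
    {x : ℝ → E} {x₀ : E} (hS : IsCompact {y ∈ M | V y ≤ c})
    (hF : ContinuousOn F {y ∈ M | V y ≤ c}) (hVc : ContinuousOn V {y ∈ M | V y ≤ c})
    (hμ : 0 < μ) (hc : 0 < c)
    (hRate : ∀ y ∈ M, V y ≤ c → LV y ≤ -μ * V y)
    (hV0 : ∀ y ∈ M, V y ≤ c → 0 ≤ V y) (hZ : ∀ y ∈ M, V y ≤ c → V y = 0 → y = x₀)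
    (hx₀ : x₀ ∈ M) (hVx₀ : V x₀ = 0)
    (hx : ContinuousOn x (Ici 0)) (hxF : ∀ t, 0 ≤ t → HasDerivWithinAt x (F (x t)) (Ici t) t)
    (hφ : ∀ t, 0 ≤ t → HasDerivWithinAt (V ∘ x) (LV (x t)) (Ici t) t)
    (hxM : ∀ t, 0 ≤ t → x t ∈ M) (h0c : V (x 0) ≤ c) :
    (∀ t, 0 ≤ t → V (x t) ≤ c ∧ V (x t) ≤ V (x 0) * Real.exp (-μ * t)) ∧
      Tendsto x atTop (𝓝 x₀) := by
  exact certificate_exp_decay_univ (W := fun y ↦ μ * V y) hS hF hVc (continuousOn_const.mul hVc)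
    (fun y hy hVy ↦ by simpa [neg_mul] using hRate y hy hVy)
    (fun y hy hVy ↦ mul_nonneg hμ.le (hV0 y hy hVy))
    (fun y _ hVy ↦ by show 0 < μ * V y; rw [hVy]; exact mul_pos hμ hc) hx₀
    (by rw [hVx₀]; exact hc.le)
    (by simp [hVx₀]) (fun y hy hVy hWy ↦ hZ y hy hVy (by
      have h' : μ * V y = 0 := hWy
      rcases mul_eq_zero.1 h' with h | h
      · exact absurd h hμ.ne'
      · exact h)) hRate hx hxF hφ hxM h0c

end Certificate

end Summit.Ventures.GridStability.Lyapunov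

end
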